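import Summits.QuantumFields.YangMills.Theorems.BalabanUVNodesPortU8LiftFields
import Literature.MathematicalPhysics.QuantumFieldTheory.Balaban1983to89.B6SectACriticalPointV1

/-!
# PORT PT-B (U8), g3 file 7 — THE [B6] Sect. A DOMAIN FAMILY OF A WINDOW, UNFOLDED: `Λ₀ =` the fine sites whose `(k+1)`-block is OUTSIDE the window (datum pinned, `B₀ = 0`),
# `Λ_j = ∅` for `1 ≤ j ≤ k`, `Λ_{k+1} =` the window ∕ the coarse bonds touching it; the kernel of `Q′` and the constraint `QA = B` read at these names; SUPPORTS: a field pinned on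
# `Λ₀` lives on bonds issuing from the one-step neighbourhood of the window region, a `Q′`-kernel test function on the window region — fourth part of the (R4ᴰ-Loc) TRANSPORT lemma

Cell `ym-nodeO-ideate` ∕ `ym-balaban-port`, porter `ymgap-nodeO-port-PTB-1` (gen 3), item **stmt-QuantumFields-27931** `BalabanUVNodes.PortPieceLocalityU8`
(text ⁷⁗ «v10-Loc» `d796c7a1386a82f1`).  `--supports stmt-QuantumFields-27931` (helper).  [B6] = [Balaban1984PropagatorsII], [I] = [Balaban1987RG1].

WHAT THIS FILE PROVES (theorems only; no `def ∕ instance ∕ notation ∕ sorry`; standard axioms), for `D := windowDomains F k K hk W` (ed.16):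
* §1 `iterBlockOf_eq_of_blockOf_eq`, `exists_iterBlockOf_eq` (the block maps are onto, standing range);
* §2 `deep_windowDomains_zero_iff` (`Deep 0 x ↔ block x ∈ W`), `lamBond_windowDomains_zero_iff` (both ends outside the window region), `not_lamSite ∕ not_lamBond_windowDomains_mid`
  (`1 ≤ j ≤ k`), `mem_Om_windowDomains_top_iff` (`Ω_{k+1}^{(k+1)} = W`), `lamSite ∕ lamBond_windowDomains_top_iff`;
* §3 ★ `mem_ker_QpE_windowDomains_iff` (`n ∈ N(Q′) ↔ n = 0` off the window region `∧ Q′_{k+1}n = 0` on `W`), ★ `QE_windowDomains_eq_zero_iff`, ★ `QE_windowDomains_eq_windowSrc_iff`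
  (`QA = e_l ↔ A = 0` on the exterior–exterior bonds `∧ (Q_{k+1}A)(c) = [c = ⟨l₂, l₁⟩]` on the coarse bonds touching `W`);
* §4 supports in the integer box `Reg_j(z₀, R)` of file 5 (any volume): `exists_inBox_of_ne_zero_site` (a function vanishing off the window region), `exists_inBox_src_of_ne_zero_bond`
  (a bond field vanishing on the exterior–exterior bonds lives on bonds with source in `Reg_1`), `laplace_eq_zero_of_support`, `curl_eq_zero_of_support`, `diverg`-free.
HONEST FRAMING.  Bookkeeping over DEF-1's ed.16 names and r03's [B6] Sect. A files; nothing of Bałaban asserted∕ported∕discharged; 27931 OPEN · SIGNED v10-Loc · close HOLD (№495);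
K0⁷ OPEN; NODE O 0∕1; COUNT 8∕28 · K 1∕4 UNMOVED; finite `𝕋⁴_{L^K}` at fixed ε — NOT continuum ∕ OS ∕ Clay; **the Yang–Mills mass gap (Clay) is NOT proved by any of this.**
-/

noncomputable section

open scoped BigOperators

namespace Summit.QuantumFields.YangMills.Theorems.PortU8

open Literature.MathematicalPhysics.QuantumFieldTheory.Balaban1983to89
open Literature.MathematicalPhysics.QuantumFieldTheory.Balaban1983to89.Node00
open Literature.MathematicalPhysics.QuantumFieldTheory.Balaban1983to89.T4Continuum (T4Family)
open Literature.MathematicalPhysics.QuantumFieldTheory.Balaban1983to89.B5Eq118OneStroke (iterBlockOf iterBlock)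
open Literature.MathematicalPhysics.QuantumFieldTheory.Balaban1983to89.LatticeFieldCalculus
open Literature.MathematicalPhysics.QuantumFieldTheory.Balaban1983to89.B6SectAOperatorsV1 (QE QpE)
open Literature.MathematicalPhysics.QuantumFieldTheory.BalabanImbrieJaffe1984to88.BIJ85AxialPropagator411 (BondSpace PlaqSpace)
open Summit.QuantumFields.YangMills.Theorems.K0RecordFormatNames

variable (F : T4Family)

/-! ## §1  Block maps: dependence on the first block only, and surjectivity -/

/-- The higher block points of a fine site depend only on its first block. [cite: Balaban1984PropagatorsI, (1.18) p.20 (bookkeeping)] -/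
theorem iterBlockOf_eq_of_blockOf_eq {P : Params} {x x' : Site P 0} (h : blockOf x = blockOf x') : ∀ (j : ℕ), 1 ≤ j → iterBlockOf j x = iterBlockOf j x'
  | 0, hj => absurd hj (by omega)
  | 1, _ => h
  | j + 2, _ => by
    show blockOf (iterBlockOf (j + 1) x) = blockOf (iterBlockOf (j + 1) x')
    rw [iterBlockOf_eq_of_blockOf_eq h (j + 1) (by omega)]

/-- The higher block points depend only on a lower block point. [cite: Balaban1984PropagatorsI, (1.18) p.20 (bookkeeping)] -/
theorem iterBlockOf_eq_of_iterBlockOf_eq {P : Params} {x x' : Site P 0} {j : ℕ} (h : iterBlockOf j x = iterBlockOf j x') {j' : ℕ} (hj : j ≤ j') :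
    iterBlockOf j' x = iterBlockOf j' x' := by
  induction j' with
  | zero =>
    obtain rfl : j = 0 := Nat.le_zero.mp hj
    exact h
  | succ j' ih =>
    rcases Nat.lt_or_eq_of_le hj with hlt | heq
    · show blockOf (iterBlockOf j' x) = blockOf (iterBlockOf j' x')
      rw [ih (by omega)]
    · subst heq; exact h

/-- **The block maps are onto** (standing range): every `j`-site is the `j`-block of some fine site. [cite: Balaban1984PropagatorsI, (1.6) p.18 (bookkeeping)] -/
theorem exists_iterBlockOf_eq (K j : ℕ) (hj : j ≤ F.m + K) (y : Site (F.P K) j) : ∃ x : Site (F.P K) 0, iterBlockOf j x = y := by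
  have hjK : j ≤ (F.P K).m + (F.P K).K := by simpa using hj
  set c : Fin 4 → ℤ := fun i => ((y (Fin.cast (F.P_d K).symm i)).valMinAbs : ℤ)
  refine ⟨siteOfInt F K 0 fun i => c i * (F.L : ℤ) ^ j, ?_⟩
  rw [iterBlockOf_siteOfInt F K j hjK]
  have hL : ((F.L : ℤ) ^ j) ≠ 0 := by have := (F.P K).L_pos; positivity
  simp only [Int.mul_ediv_cancel _ hL]
  exact siteOfInt_valMinAbs F K j y

/-! ## §2  The domain family of a window, unfolded -/

section Dom

variable {k K : ℕ} (hk : k + 1 ≤ (F.P K).m + (F.P K).K) (W : Finset (Site (F.P K) (k + 1)))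

/-- `Ω_j^{(j)}` for `1 ≤ j ≤ k + 1`, unfolded. [cite: Balaban1984PropagatorsII, (2.1) p.224 (bookkeeping)] -/
theorem mem_Om_windowDomains_iff {j : ℕ} (hj1 : 1 ≤ j) (hj2 : j ≤ k + 1) (y : Site (F.P K) j) :
    y ∈ (windowDomains F k K hk W).Om j ↔ ∀ x : Site (F.P K) 0, iterBlockOf j x = y → iterBlockOf (k + 1) x ∈ W := by
  have h1 : j ≠ 0 := by omega
  simp [windowDomains, h1, hj2]

/-- **`Deep 0 x ↔` the `(k+1)`-block of `x` lies in the window.** [cite: Balaban1984PropagatorsII, (2.3) p.224; Balaban1987RG1, p.275 L5–8] -/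
theorem deep_windowDomains_zero_iff (x : Site (F.P K) 0) : (windowDomains F k K hk W).Deep 0 x ↔ iterBlockOf (k + 1) x ∈ W := by
  show blockOf x ∈ (windowDomains F k K hk W).Om (0 + 1) ↔ _
  rw [mem_Om_windowDomains_iff F hk W le_rfl (by omega)]
  constructor
  · intro h; exact h x rfl
  · intro h x' hx'
    have hb : blockOf x' = blockOf x := by simpa using hx'
    rwa [iterBlockOf_eq_of_blockOf_eq hb (k + 1) (by omega)]

/-- `Λ₀` (sites): the fine sites whose `(k+1)`-block is OUTSIDE the window. [cite: Balaban1984PropagatorsII, (2.3) p.224] -/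
theorem lamSite_windowDomains_zero_iff (x : Site (F.P K) 0) : (windowDomains F k K hk W).LamSite 0 x ↔ iterBlockOf (k + 1) x ∉ W := by
  rw [B6SectADomainsV1.Domains.lamSite_zero_iff, deep_windowDomains_zero_iff]

/-- `Λ₀` (bonds): both end-points outside the window region. [cite: Balaban1984PropagatorsII, (2.3) p.224] -/
theorem lamBond_windowDomains_zero_iff (b : PBond (F.P K) 0) :
    (windowDomains F k K hk W).LamBond 0 b ↔ iterBlockOf (k + 1) b.src ∉ W ∧ iterBlockOf (k + 1) b.tgt ∉ W := by
  rw [B6SectADomainsV1.Domains.lamBond_zero_iff, deep_windowDomains_zero_iff, deep_windowDomains_zero_iff]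

/-- At the middle levels `1 ≤ j ≤ k` every site of `Ω_j^{(j)}` is deep. [cite: Balaban1984PropagatorsII, (2.3) p.224 (bookkeeping)] -/
theorem deep_windowDomains_mid {j : ℕ} (hj1 : 1 ≤ j) (hj2 : j ≤ k) {y : Site (F.P K) j} (hy : y ∈ (windowDomains F k K hk W).Om j) :
    (windowDomains F k K hk W).Deep j y := by
  show blockOf y ∈ (windowDomains F k K hk W).Om (j + 1)
  rw [mem_Om_windowDomains_iff F hk W hj1 (by omega)] at hy
  rw [mem_Om_windowDomains_iff F hk W (by omega) (by omega)]
  intro x hx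
  obtain ⟨x₀, hx₀⟩ := exists_iterBlockOf_eq F K j (by have := hk; simp only [T4Family.P_m, T4Family.P_K] at this; omega) y
  have h1 : iterBlockOf (j + 1) x₀ = iterBlockOf (j + 1) x := by rw [B5Eq118OneStroke.iterBlockOf_succ, hx₀, hx]
  rw [← iterBlockOf_eq_of_iterBlockOf_eq h1 (by omega)]
  exact hy x₀ hx₀

/-- `Λ_j = ∅` (sites) for `1 ≤ j ≤ k`. [cite: Balaban1984PropagatorsII, (2.3) p.224] -/
theorem not_lamSite_windowDomains_mid {j : ℕ} (hj1 : 1 ≤ j) (hj2 : j ≤ k) (y : Site (F.P K) j) : ¬ (windowDomains F k K hk W).LamSite j y :=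
  fun h => h.2 (deep_windowDomains_mid F hk W hj1 hj2 h.1)

/-- `Λ_j = ∅` (bonds) for `1 ≤ j ≤ k`. [cite: Balaban1984PropagatorsII, (2.3) p.224] -/
theorem not_lamBond_windowDomains_mid {j : ℕ} (hj1 : 1 ≤ j) (hj2 : j ≤ k) (b : PBond (F.P K) j) : ¬ (windowDomains F k K hk W).LamBond j b := by
  rintro ⟨hmem, hs, ht⟩
  rcases hmem with h | h
  · exact hs (deep_windowDomains_mid F hk W hj1 hj2 h)
  · exact ht (deep_windowDomains_mid F hk W hj1 hj2 h)

/-- **`Ω_{k+1}^{(k+1)} = W`.** [cite: Balaban1984PropagatorsII, (2.1) p.224; Balaban1987RG1, p.275 L5–8] -/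
theorem mem_Om_windowDomains_top_iff (y : Site (F.P K) (k + 1)) : y ∈ (windowDomains F k K hk W).Om (k + 1) ↔ y ∈ W := by
  rw [mem_Om_windowDomains_iff F hk W (by omega) le_rfl]
  constructor
  · intro h
    obtain ⟨x, hx⟩ := exists_iterBlockOf_eq F K (k + 1) (by have := hk; simp only [T4Family.P_m, T4Family.P_K] at this; omega) y
    rw [← hx]; exact h x hx
  · intro h x hx; rwa [hx]

/-- `Λ_{k+1}` (sites) `= W`. [cite: Balaban1984PropagatorsII, (2.3) p.224] -/
theorem lamSite_windowDomains_top_iff (y : Site (F.P K) (k + 1)) : (windowDomains F k K hk W).LamSite (k + 1) y ↔ y ∈ W := by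
  exact ((windowDomains F k K hk W).lamSite_top_iff y).trans (mem_Om_windowDomains_top_iff F hk W y)

/-- `Λ_{k+1}` (bonds): the coarse bonds touching the window. [cite: Balaban1984PropagatorsII, (2.3) p.224] -/
theorem lamBond_windowDomains_top_iff (c : PBond (F.P K) (k + 1)) : (windowDomains F k K hk W).LamBond (k + 1) c ↔ c.src ∈ W ∨ c.tgt ∈ W := by
  exact ((windowDomains F k K hk W).lamBond_top_iff c).trans (or_congr (mem_Om_windowDomains_top_iff F hk W _) (mem_Om_windowDomains_top_iff F hk W _))

/-! ## §3  `N(Q′)` and the constraints at these names -/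

/-- ★ **`n ∈ N(Q′)` for the window family**: `n = 0` at every fine site outside the window region and `Q′_{k+1}n = 0` on `W` (the middle levels are void).
[cite: Balaban1984PropagatorsII, (2.7) p.224, (2.10) p.225] -/
theorem mem_ker_QpE_windowDomains_iff (n : B6SectAOperatorsV1.ScalarSpace (F.P K)) :
    n ∈ LinearMap.ker (QpE (windowDomains F k K hk W)) ↔
      (∀ x : Site (F.P K) 0, iterBlockOf (k + 1) x ∉ W → n x = 0) ∧ (∀ y ∈ W, siteAvgIter (k + 1) (WithLp.ofLp n) y = 0) := by
  rw [B6SectAOperatorsV1.mem_ker_QpE_iff]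
  constructor
  · intro h
    refine ⟨fun x hx => ?_, fun y hy => h (k + 1) y ((lamSite_windowDomains_top_iff F hk W y).2 hy)⟩
    have := h 0 x ((lamSite_windowDomains_zero_iff F hk W x).2 hx)
    simpa [siteAvgIter] using this
  · rintro ⟨h0, htop⟩ j y hy
    have hjk : j ≤ k + 1 := (windowDomains F k K hk W).le_of_lamSite hy
    rcases Nat.eq_zero_or_pos j with rfl | hj
    · simpa [siteAvgIter] using h0 y ((lamSite_windowDomains_zero_iff F hk W y).1 hy)
    · rcases Nat.lt_or_eq_of_le hjk with hlt | rfl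
      · exact absurd hy (not_lamSite_windowDomains_mid F hk W hj (by omega) y)
      · exact htop y ((lamSite_windowDomains_top_iff F hk W y).1 hy)

/-- ★ **`QA = 0` for the window family**: `A = 0` on the exterior–exterior fine bonds and `Q_{k+1}A = 0` on the coarse bonds touching `W`.
[cite: Balaban1984PropagatorsII, (2.6) p.224, (2.20) p.226] -/
theorem QE_windowDomains_eq_zero_iff (x : BondSpace (F.P K)) :
    QE (windowDomains F k K hk W) x = 0 ↔
      (∀ b : PBond (F.P K) 0, iterBlockOf (k + 1) b.src ∉ W → iterBlockOf (k + 1) b.tgt ∉ W → x b = 0) ∧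
      (∀ c : PBond (F.P K) (k + 1), (c.src ∈ W ∨ c.tgt ∈ W) → bondAvgIter (k + 1) (WithLp.ofLp x) c = 0) := by
  rw [B6SectAOperatorsV1.QE_eq_zero_iff]
  constructor
  · intro h
    refine ⟨fun b hs ht => ?_, fun c hc => h (k + 1) c ((lamBond_windowDomains_top_iff F hk W c).2 hc)⟩
    have := h 0 b ((lamBond_windowDomains_zero_iff F hk W b).2 ⟨hs, ht⟩)
    simpa [bondAvgIter] using this
  · rintro ⟨h0, htop⟩ j b hb
    have hjk : j ≤ k + 1 := (windowDomains F k K hk W).le_of_lamBond hb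
    rcases Nat.eq_zero_or_pos j with rfl | hj
    · obtain ⟨hs, ht⟩ := (lamBond_windowDomains_zero_iff F hk W b).1 hb
      simpa [bondAvgIter] using h0 b hs ht
    · rcases Nat.lt_or_eq_of_le hjk with hlt | rfl
      · exact absurd hb (not_lamBond_windowDomains_mid F hk W hj (by omega) b)
      · exact htop b ((lamBond_windowDomains_top_iff F hk W b).1 hb)

/-- The localized source at a top-level index: the indicator of the coarse bond `⟨l₂, l₁⟩`. [cite: Balaban1984PropagatorsII, (2.6) p.224; Balaban1987RG1, (3.25) p.275] -/
theorem windowSrc_apply (l : RespLabel F k K) (i : B6SectAOperatorsV1.BondIdx (windowDomains F k K hk W)) :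
    windowSrc F k K hk W l i = if ((i.1.1 : ℕ) = k + 1 ∧ i.1.2.dir = l.1 ∧ ∃ x : Site (F.P K) 0, iterBlockOf (i.1.1 : ℕ) x = i.1.2.src ∧ iterBlockOf (k + 1) x = l.2)
      then 1 else 0 := rfl

/-- ★ **`QA = e_l` for the window family**: `A = 0` on the exterior–exterior fine bonds and `(Q_{k+1}A)(c) = [c = ⟨l₂, l₁⟩]` on the coarse bonds touching `W`.
[cite: Balaban1984PropagatorsII, (2.6) p.224, (2.20) p.226; Balaban1987RG1, (3.25) p.275] -/
theorem QE_windowDomains_eq_windowSrc_iff (l : RespLabel F k K) (x : BondSpace (F.P K)) :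
    QE (windowDomains F k K hk W) x = windowSrc F k K hk W l ↔
      (∀ b : PBond (F.P K) 0, iterBlockOf (k + 1) b.src ∉ W → iterBlockOf (k + 1) b.tgt ∉ W → x b = 0) ∧
      (∀ c : PBond (F.P K) (k + 1), (c.src ∈ W ∨ c.tgt ∈ W) → bondAvgIter (k + 1) (WithLp.ofLp x) c = if c = ⟨l.2, l.1⟩ then 1 else 0) := by
  classical
  have hsurj := exists_iterBlockOf_eq F K (k + 1) (by have := hk; simp only [T4Family.P_m, T4Family.P_K] at this; omega)
  -- the value of the source at a top index
  have htop : ∀ (c : PBond (F.P K) (k + 1)) (hc : (windowDomains F k K hk W).LamBond (k + 1) c),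
      windowSrc F k K hk W l ⟨⟨⟨k + 1, by show k + 1 < (windowDomains F k K hk W).k + 1; exact Nat.lt_succ_self _⟩, c⟩, hc⟩ = if c = ⟨l.2, l.1⟩ then 1 else 0 := by
    intro c hc
    rw [windowSrc_apply]
    have hiff : (c.dir = l.1 ∧ ∃ x : Site (F.P K) 0, iterBlockOf (k + 1) x = c.src ∧ iterBlockOf (k + 1) x = l.2) ↔ c = ⟨l.2, l.1⟩ := by
      constructor
      · rintro ⟨hd, x, hx1, hx2⟩
        cases c; simp only at hd hx1 ⊢; rw [← hx1, hx2, hd]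
      · rintro rfl
        obtain ⟨x, hx⟩ := hsurj l.2
        exact ⟨rfl, x, hx, hx⟩
    split_ifs with h1 h2 h2
    · rfl
    · exact absurd (hiff.1 h1.2) h2
    · exact absurd ⟨rfl, hiff.2 h2⟩ h1
    · rfl
  -- the value at a bottom index is `0`
  have hbot : ∀ (b : PBond (F.P K) 0) (hb : (windowDomains F k K hk W).LamBond 0 b),
      windowSrc F k K hk W l ⟨⟨⟨0, Nat.succ_pos _⟩, b⟩, hb⟩ = 0 := by
    intro b hb
    rw [windowSrc_apply]
    have : ¬ ((0 : ℕ) = k + 1 ∧ b.dir = l.1 ∧ ∃ x : Site (F.P K) 0, iterBlockOf 0 x = b.src ∧ iterBlockOf (k + 1) x = l.2) := fun h => by omega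
    exact if_neg this
  constructor
  · intro h
    refine ⟨fun b hs ht => ?_, fun c hc => ?_⟩
    · have hb : (windowDomains F k K hk W).LamBond 0 b := (lamBond_windowDomains_zero_iff F hk W b).2 ⟨hs, ht⟩
      have := congrArg (fun g => g ⟨⟨⟨0, Nat.succ_pos _⟩, b⟩, hb⟩) h
      simp only [B6SectAOperatorsV1.QE_apply] at this
      rw [hbot b hb] at this
      simpa [bondAvgIter] using this
    · have hc' : (windowDomains F k K hk W).LamBond (k + 1) c := (lamBond_windowDomains_top_iff F hk W c).2 hc
      have := congrArg (fun g => g ⟨⟨⟨k + 1, by show k + 1 < (windowDomains F k K hk W).k + 1; exact Nat.lt_succ_self _⟩, c⟩, hc'⟩) h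
      simp only [B6SectAOperatorsV1.QE_apply] at this
      rw [htop c hc'] at this
      exact this
  · rintro ⟨h0, ht⟩
    ext i
    obtain ⟨⟨⟨j, hj⟩, b⟩, hb⟩ := i
    rw [B6SectAOperatorsV1.QE_apply]
    simp only
    have hjk : j ≤ k + 1 := by have := (windowDomains F k K hk W).le_of_lamBond hb; exact this
    rcases Nat.eq_zero_or_pos j with rfl | hjpos
    · obtain ⟨hs, hts⟩ := (lamBond_windowDomains_zero_iff F hk W b).1 hb
      rw [hbot b hb]
      simpa [bondAvgIter] using h0 b hs hts
    · rcases Nat.lt_or_eq_of_le hjk with hlt | rfl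
      · exact absurd hb (not_lamBond_windowDomains_mid F hk W hjpos (by omega) b)
      · rw [htop b hb]
        exact ht b ((lamBond_windowDomains_top_iff F hk W b).1 hb)

end Dom

/-! ## §4  Supports in the integer box `Reg_j(z₀, R)` (any volume) -/

section Support

/-- `(x + e_μ) − e_μ = x` on the record's tori. [folklore] -/
theorem unshift_shift' {K j : ℕ} (x : Site (F.P K) j) (μ : Fin (F.P K).d) : (x.shift μ).unshift μ = x := by
  funext ν
  by_cases h : ν = μ
  · subst h; simp [Site.shift, Site.unshift]
  · have h1 : (x.shift μ).unshift μ ν = (x.shift μ) ν := Function.update_of_ne h _ _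
    have h2 : (x.shift μ) ν = x ν := Function.update_of_ne h _ _
    rw [h1, h2]

/-- `(x − e_μ) + e_μ = x` on the record's tori. [folklore] -/
theorem shift_unshift' {K j : ℕ} (x : Site (F.P K) j) (μ : Fin (F.P K).d) : (x.unshift μ).shift μ = x := by
  funext ν
  by_cases h : ν = μ
  · subst h; simp [Site.shift, Site.unshift]
  · have h1 : (x.unshift μ).shift μ ν = (x.unshift μ) ν := Function.update_of_ne h _ _
    have h2 : (x.unshift μ) ν = x ν := Function.update_of_ne h _ _
    rw [h1, h2]

variable {k K R : ℕ} {z₀ : Fin 4 → ℤ}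

/-- If `s + e_μ = Φ z` then `s = Φ (z − e_μ)`. [folklore] -/
theorem eq_siteOfInt_sub_of_shift_eq {s : Site (F.P K) 0} {z : Fin 4 → ℤ} {μ : Fin (F.P K).d} (h : s.shift μ = siteOfInt F K 0 z) :
    s = siteOfInt F K 0 (z - Pi.single (Fin.cast (F.P_d K) μ) 1) := by
  rw [siteOfInt_sub_single, ← h, unshift_shift' F]

/-- If `s − e_μ = Φ z` then `s = Φ (z + e_μ)`. [folklore] -/
theorem eq_siteOfInt_add_of_unshift_eq {s : Site (F.P K) 0} {z : Fin 4 → ℤ} {μ : Fin (F.P K).d} (h : s.unshift μ = siteOfInt F K 0 z) :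
    s = siteOfInt F K 0 (z + Pi.single (Fin.cast (F.P_d K) μ) 1) := by
  rw [siteOfInt_add_single, ← h, shift_unshift' F]

/-- ★ **A function vanishing off the window region is supported on `Reg_0`**: `n s ≠ 0 ⇒ s = Φ z`, `z ∈ Reg_0(z₀, R)`. [cite: Balaban1987RG1, (1.21) p.264 (bookkeeping)] -/
theorem exists_inBox_of_ne_zero_site {V : Type*} [Zero V] (hk : k + 1 ≤ F.m + K) (hnw : NoWrapAt F k K R z₀) {n : Site (F.P K) 0 → V}
    (hn : ∀ s, iterBlockOf (k + 1) s ∉ recordWindow F k K R z₀ → n s = 0) {s : Site (F.P K) 0} (hs : n s ≠ 0) :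
    ∃ z : Fin 4 → ℤ, siteOfInt F K 0 z = s ∧ ∀ i, (z₀ i - R) * (F.L : ℤ) ^ (k + 1) - (0 : ℕ) ≤ z i ∧ z i ≤ (z₀ i + R + 1) * (F.L : ℤ) ^ (k + 1) - 1 + (0 : ℕ) := by
  by_contra hne
  exact hs (hn s fun hmem => hne (exists_inBox_of_iterBlockOf_mem F hk (fun i => NoWrapAt.two_mul_lt F hnw (Nat.le_succ R) i) hmem))

/-- ★ **The Laplacian of a function vanishing off the window region is supported on `Reg_1`.** [cite: Balaban1984PropagatorsI, (1.21) p.21 (bookkeeping)] -/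
theorem exists_inBox_of_laplace_ne_zero {V : Type*} [AddCommGroup V] [Module ℝ V] (hk : k + 1 ≤ F.m + K) (hnw : NoWrapAt F k K R z₀) (c : ℝ)
    {n : Site (F.P K) 0 → V} (hn : ∀ s, iterBlockOf (k + 1) s ∉ recordWindow F k K R z₀ → n s = 0) {s : Site (F.P K) 0} (hs : laplace c n s ≠ 0) :
    ∃ z : Fin 4 → ℤ, siteOfInt F K 0 z = s ∧ ∀ i, (z₀ i - R) * (F.L : ℤ) ^ (k + 1) - (1 : ℕ) ≤ z i ∧ z i ≤ (z₀ i + R + 1) * (F.L : ℤ) ^ (k + 1) - 1 + (1 : ℕ) := by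
  by_contra hne
  apply hs
  have h0 : n s = 0 := by
    by_contra h
    obtain ⟨z, hz, hb⟩ := exists_inBox_of_ne_zero_site F hk hnw hn h
    exact hne ⟨z, hz, inBox_mono F (Nat.zero_le 1) hb⟩
  have h1 : ∀ μ, n (s.shift μ) = 0 := fun μ => by
    by_contra h
    obtain ⟨z, hz, hb⟩ := exists_inBox_of_ne_zero_site F hk hnw hn h
    exact hne ⟨_, (eq_siteOfInt_sub_of_shift_eq F hz.symm).symm, inBox_sub_single F _ hb⟩
  have h2 : ∀ μ, n (s.unshift μ) = 0 := fun μ => by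
    by_contra h
    obtain ⟨z, hz, hb⟩ := exists_inBox_of_ne_zero_site F hk hnw hn h
    exact hne ⟨_, (eq_siteOfInt_add_of_unshift_eq F hz.symm).symm, inBox_add_single F _ hb⟩
  simp [laplace, h0, h1, h2]

/-- ★ **A bond field vanishing on the exterior–exterior bonds lives on bonds with source in `Reg_1`.** [cite: Balaban1984PropagatorsII, (2.6) p.224 (bookkeeping)] -/
theorem exists_inBox_src_of_ne_zero_bond {V : Type*} [Zero V] (hk : k + 1 ≤ F.m + K) (hnw : NoWrapAt F k K R z₀) {A : PBond (F.P K) 0 → V}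
    (hA : ∀ b, iterBlockOf (k + 1) b.src ∉ recordWindow F k K R z₀ → iterBlockOf (k + 1) b.tgt ∉ recordWindow F k K R z₀ → A b = 0)
    {b : PBond (F.P K) 0} (hb : A b ≠ 0) :
    ∃ z : Fin 4 → ℤ, siteOfInt F K 0 z = b.src ∧ ∀ i, (z₀ i - R) * (F.L : ℤ) ^ (k + 1) - (1 : ℕ) ≤ z i ∧ z i ≤ (z₀ i + R + 1) * (F.L : ℤ) ^ (k + 1) - 1 + (1 : ℕ) := by
  have hc : ∀ i, 2 * (|z₀ i| + R) < ((F.P K).sitesPerDir (k + 1) : ℤ) := fun i => NoWrapAt.two_mul_lt F hnw (Nat.le_succ R) i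
  by_contra hne
  apply hb (hA b ?_ ?_)
  · intro h
    obtain ⟨z, hz, hbz⟩ := exists_inBox_of_iterBlockOf_mem F hk hc h
    exact hne ⟨z, hz, inBox_mono F (Nat.zero_le 1) hbz⟩
  · intro h
    obtain ⟨z, hz, hbz⟩ := exists_inBox_of_iterBlockOf_mem F hk hc h
    exact hne ⟨_, (eq_siteOfInt_sub_of_shift_eq F (show b.src.shift b.dir = siteOfInt F K 0 z from hz.symm)).symm, inBox_sub_single F _ hbz⟩

/-- ★ **The curl of a bond field vanishing on the exterior–exterior bonds lives on plaquettes based in `Reg_2`.** [cite: Balaban1984PropagatorsI, (1.2) p.18 (bookkeeping)] -/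
theorem exists_inBox_src_of_curl_ne_zero {V : Type*} [AddCommGroup V] [Module ℝ V] (hk : k + 1 ≤ F.m + K) (hnw : NoWrapAt F k K R z₀) (c : ℝ)
    {A : PBond (F.P K) 0 → V} (hA : ∀ b, iterBlockOf (k + 1) b.src ∉ recordWindow F k K R z₀ → iterBlockOf (k + 1) b.tgt ∉ recordWindow F k K R z₀ → A b = 0)
    {p : Plaq (F.P K) 0} (hp : curl c A p ≠ 0) :
    ∃ z : Fin 4 → ℤ, siteOfInt F K 0 z = p.src ∧ ∀ i, (z₀ i - R) * (F.L : ℤ) ^ (k + 1) - (2 : ℕ) ≤ z i ∧ z i ≤ (z₀ i + R + 1) * (F.L : ℤ) ^ (k + 1) - 1 + (2 : ℕ) := by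
  by_contra hne
  apply hp
  have h1 : A ⟨p.src, p.μ⟩ = 0 := by
    by_contra h
    obtain ⟨z, hz, hb⟩ := exists_inBox_src_of_ne_zero_bond F hk hnw hA h
    exact hne ⟨z, hz, inBox_mono F (by norm_num) hb⟩
  have h4 : A ⟨p.src, p.ν⟩ = 0 := by
    by_contra h
    obtain ⟨z, hz, hb⟩ := exists_inBox_src_of_ne_zero_bond F hk hnw hA h
    exact hne ⟨z, hz, inBox_mono F (by norm_num) hb⟩
  have h2 : A ⟨p.src.shift p.μ, p.ν⟩ = 0 := by
    by_contra h
    obtain ⟨z, hz, hb⟩ := exists_inBox_src_of_ne_zero_bond F hk hnw hA h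
    exact hne ⟨_, (eq_siteOfInt_sub_of_shift_eq F (show p.src.shift p.μ = siteOfInt F K 0 z from hz.symm)).symm, inBox_sub_single F _ hb⟩
  have h3 : A ⟨p.src.shift p.ν, p.μ⟩ = 0 := by
    by_contra h
    obtain ⟨z, hz, hb⟩ := exists_inBox_src_of_ne_zero_bond F hk hnw hA h
    exact hne ⟨_, (eq_siteOfInt_sub_of_shift_eq F (show p.src.shift p.ν = siteOfInt F K 0 z from hz.symm)).symm, inBox_sub_single F _ hb⟩
  simp [curl, h1, h2, h3, h4]

end Support

end Summit.QuantumFields.YangMills.Theorems.PortU8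

end
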